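import Summits.MatrixMultiplication.MatrixMultiplication.Theses.CongruenceTowerPacking
import Literature.RepresentationTheory.FiniteGroups.CharacterDegrees
import Literature.NumberTheory.Automorphic.HeckeCommonEigenvector

/-!
# `DegreeLeIndexAbelian` — character degrees are bounded by the index of an abelian subgroup

Route `MatrixMultiplication/CongruenceTowerPacking`, item `stmt-MatrixMultiplication-12345` (support):
for a finite group `G`, an abelian subgroup `A ≤ G` and an irreducible complex representation
`ρ : G → GL(V)`, `dim V ≤ [G : A]` (Isaacs, *Character Theory of Finite Groups*, Problem 2.9(b);
for normal `A` this is the easy half of Ito's theorem, ibid. Thm. 6.15).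

Proof.  The operators `ρ(a)`, `a ∈ A`, commute pairwise, so (`ℂ` algebraically closed, `V ≠ 0`
finite-dimensional) they have a common eigenvector `w ≠ 0`
(`Literature.NumberTheory.Automorphic.exists_common_eigenvector_of_forall_comm`).  For a coset
`q ∈ G/A` put `f q := ρ(q.out) w`, where `q.out` is a chosen representative.  For `g ∈ G` one has
`g · q.out = q'.out · a` with `q' = gq` and `a ∈ A`, hence `ρ(g) (f q) = ρ(q'.out) (ρ(a) w) = c • f q'`:
the span of the `[G : A]` vectors `f q` is a non-zero subrepresentation, hence all of `V` by
irreducibility, and `dim V ≤ #(G/A) = [G : A]`.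
-/

-- single-conjunct summit: the mandated namespace `Summit.MatrixMultiplication.MatrixMultiplication.…`
-- repeats `MatrixMultiplication` (summit = sub-problem), which `linter.dupNamespace` would flag.
set_option linter.dupNamespace false

namespace Summit.MatrixMultiplication.MatrixMultiplication.Theorems

open Module

/-- **Character degrees are at most the index of any abelian subgroup** (settles
`stmt-MatrixMultiplication-12345`, exact route signature
`Summit.MatrixMultiplication.MatrixMultiplication.Theses.CongruenceTowerPacking.DegreeLeIndexAbelian`):
if `G` is a finite group, `A ≤ G` is abelian and `d ∈ charDegrees G` is the dimension of an
irreducible complex representation of `G`, then `d ≤ [G : A]`.  A common eigenvector `w` of the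
commuting family `ρ(A)` spans, together with its translates `ρ(g) w` (one per coset `gA`, up to
scalars), a non-zero subrepresentation, which is everything by irreducibility.
[cite: Isaacs1976, Problem 2.9(b)] -/
theorem DegreeLeIndexAbelian_proof :
    Summit.MatrixMultiplication.MatrixMultiplication.Theses.CongruenceTowerPacking.DegreeLeIndexAbelian := by
  unfold Summit.MatrixMultiplication.MatrixMultiplication.Theses.CongruenceTowerPacking.DegreeLeIndexAbelian
  intro G _ _ A hA d hd
  obtain ⟨V, _, _, _, ρ, hρ, rfl⟩ := hd
  classical
  haveI : ρ.IsIrreducible := hρ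
  -- the lattice conventions of `Subrepresentation`
  have hbot : (⊥ : Subrepresentation ρ).toSubmodule = ⊥ := rfl
  have htop : (⊤ : Subrepresentation ρ).toSubmodule = ⊤ := rfl
  -- `V ≠ 0` since an irreducible representation has `⊥ ≠ ⊤`
  have hV : (⊤ : Submodule ℂ V) ≠ ⊥ := by
    intro h
    apply (bot_ne_top : (⊥ : Subrepresentation ρ) ≠ ⊤)
    apply Subrepresentation.toSubmodule_injective
    rw [hbot, htop, h]
  -- a common eigenvector of the commuting family `ρ(A)`
  obtain ⟨w, -, hw0, hw⟩ :=
    Literature.NumberTheory.Automorphic.exists_common_eigenvector_of_forall_comm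
      (⊤ : Submodule ℂ V) hV (Set.range fun a : A => ρ (a : G))
      (fun _ _ _ _ => Submodule.mem_top)
      (by
        rintro _ ⟨a, rfl⟩ _ ⟨b, rfl⟩ m -
        change (ρ (a : G) * ρ (b : G)) m = (ρ (b : G) * ρ (a : G)) m
        rw [← map_mul, ← map_mul, hA _ a.2 _ b.2])
  have hw' : ∀ a : G, a ∈ A → ∃ c : ℂ, ρ a w = c • w := fun a ha => hw _ ⟨⟨a, ha⟩, rfl⟩
  -- one vector per coset of `A`
  set f : G ⧸ A → V := fun q => ρ q.out w with hf
  -- the span of the `f q` is `G`-stable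
  have hstab : ∀ g : G, ∀ v ∈ Submodule.span ℂ (Set.range f),
      ρ g v ∈ Submodule.span ℂ (Set.range f) := by
    intro g v hv
    have hle : (Submodule.span ℂ (Set.range f)).map (ρ g) ≤ Submodule.span ℂ (Set.range f) := by
      rw [Submodule.map_span_le]
      rintro _ ⟨q, rfl⟩
      obtain ⟨h, hh⟩ := QuotientGroup.mk_out_eq_mul A (g * q.out)
      obtain ⟨c, hc⟩ := hw' ((h : G)⁻¹) (A.inv_mem h.2)
      have key : ρ g (f q) = c • f (QuotientGroup.mk (g * q.out)) := by
        simp only [hf]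
        rw [hh, ← map_smul, ← hc, ← Module.End.mul_apply, ← map_mul, ← Module.End.mul_apply,
          ← map_mul, mul_inv_cancel_right]
      rw [key]
      exact Submodule.smul_mem _ _ (Submodule.subset_span ⟨_, rfl⟩)
    exact hle (Submodule.mem_map_of_mem hv)
  -- hence a subrepresentation, non-zero (it contains `f (1·A) ≠ 0`), so equal to `⊤`
  let W : Subrepresentation ρ := ⟨Submodule.span ℂ (Set.range f), fun g v hv => hstab g v hv⟩
  have hW : W = ⊤ := by
    rcases eq_bot_or_eq_top W with h | h
    · exfalso
      have h1 : f ((1 : G) : G ⧸ A) ∈ W.toSubmodule := Submodule.subset_span ⟨_, rfl⟩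
      rw [h, hbot, Submodule.mem_bot] at h1
      apply hw0
      have e : w = ρ (((1 : G) : G ⧸ A).out)⁻¹ (f ((1 : G) : G ⧸ A)) := by
        simp only [hf]
        rw [← Module.End.mul_apply, ← map_mul, inv_mul_cancel, map_one, Module.End.one_apply]
      rw [e, h1, map_zero]
    · exact h
  have hspan : Submodule.span ℂ (Set.range f) = ⊤ := by
    have e := congrArg Subrepresentation.toSubmodule hW
    rwa [htop] at e
  -- count: `dim V = dim span (range f) ≤ #(G ⧸ A) = [G : A]`
  haveI : Fintype (G ⧸ A) := Fintype.ofFinite _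
  calc finrank ℂ V = finrank ℂ (⊤ : Submodule ℂ V) := (finrank_top ℂ V).symm
    _ = (Set.range f).finrank ℂ := by rw [← hspan]; rfl
    _ ≤ Fintype.card (G ⧸ A) := finrank_range_le_card f
    _ = A.index := by rw [Subgroup.index_eq_card, Nat.card_eq_fintype_card]

end Summit.MatrixMultiplication.MatrixMultiplication.Theorems
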